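/-
Copyright (c) 2026 the pub-hodgecm-mathlib formalisation cell (harness21).  Prover seat hodgecm-mathlib-LH4-p09 (g6): Track A «(D-RAM) FOUR-FRAME» squad of crux H413, unit U2H (ii-H),
leaf (ρ2b′-X) — socket (C) (type RamM) organ (C-6) «H-SIDE-RM» ((C) lead LH4-p04 (g5) 2026-09-04T06:39Z), FILE 1∕2: ONE-FIELD LETTERS OF THE FOURTH FIELD, 2026-09-04.
-/
import Summits.HodgeConjecture.HodgeConjecture.Theorems.F0P3cDyRamHSideLevelLetter     -- ★ p857663 (LH4-p09 (g5)): `add_map_eq_and_sub_map_sq_eq` (eigen-package algebra)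
import Literature.NumberTheory.Automorphic.QuadraticDatumClassLinkOneField             -- ★ p857894 (LH4-p09 (g5)): the roots `τ, τ′` (`root_sum_and_prod`, `map_root_eq_conj`, `map_map_root_eq`)
import HarnessLib

/-!
# F0 · P3c · line LH4 «(D-RAM) FOUR-FRAME» — unit (ii-H), leaf (ρ2b′-X), socket (C), organ (C-6) FILE 1: THE FOURTH FIELD `K = Fix(Θρ)` INSIDE THE LINE MODEL `M` —
# minimality of `d_K`, the Klein letter `|ϖM − ρϖM|·|ϖM − ΘϖM| = |T − ρT|` (`d_ρ + d_Θ = 2·d_K`), the trace token through a ramified `jE`, and the `K`-uniformiser `T` of an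
# Eisenstein datum (Serre, *Local Fields* III §4, IV §1; Labesse–Langlands 1979 §2; Rogawski 1990 §4.9)

Cell `pub/hodgecm-mathlib` (D-0151), crux H413 = `stmt-HodgeConjecture-24833` (helper lane `--supports stmt-HodgeConjecture-24833 --as helper`, count-neutral); THEOREMS ONLY (no
definition, no instance, no notation, no named fact, no `sorry`, default heartbeats); ONE∕TWO-FIELD VALUATION ALGEBRA (any fields with a `ℤᵐ⁰`-valuation).  Tree socket served:
(ρ2b′-X) `stub_U2H_fixedPointCensus_typeTwo_unit0` (U2H ED. 15 :418) through the payer lineage's typed bottom socket (C) `SOCKET-hOCC.v1` (869d0c15; type RamM, `|α − ρα| < 1`,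
`e(M ∕ L⁺_v) = 4`), architecture LH4-p04 (g5) 2026-09-04T06:39Z, organ **(C-6) H-SIDE-RM** «`(q−1)(#Fix_{γ₂} + d%2) + 2 = 2·q^{n_H+1}` with `2n_H = jl − g`» dealt to LH4-p09.
FILE 2 (`F0P3cDyRamHSideClosedFormRamM`) is the place-level head; THIS file holds the one-field letters it composes, in the Klein four-group `{1, ρ, Θ, Θρ}` acting on `M`:
* §1 `valued_add_map_eq_two_of_sub_lt` — THE TRACE TOKEN: for a unit `lam`, `|lam − ρlam| < |2|·|lam + ρlam| ⇒ |lam + ρlam| = |2|` (`2lam = (lam − ρlam) + (lam + ρlam)`);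
  `valued_eq_exp_neg_two_of_mul_of_add` — ROOT SIZES `|xy| = exp(−4)`, `|x + y| ≤ exp(−4) ⇒ |x| = exp(−2)`; `map_ratioWitness_eq_neg` — `ρ r₀ = −r₀` for `r₀ = μ − μ⁻¹`,
  `μ = lam∕ρlam` (the companion of ★ p857834 `map_map_ratioWitness_eq`).
* §1 (fourth field) `valued_sub_map_le_of_fixed` — MINIMALITY OF `d_K` INSIDE `M`: `ρ, Θ` commuting involutions, doubly fixed non-zero elements of valuation in `exp(4ℤ)`, `T` a
  `Θρ`-fixed element with `|T| = exp(−2)`: every `Θρ`-fixed integer `a` has `|a − ρa| ≤ |T − ρT|` (`a = a₀ + bT`, `a₀, b` doubly fixed — `b := (a − ρa)∕(T − ρT)` —, `|b| ≤ 1` by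
  parity `exp(4ℤ)` vs `exp(4ℤ − 2)`); `v_sub_mul_v_sub_eq_of_kUniformizer` — THE KLEIN LETTER AT THE FOURTH FIELD **`|ϖM − ρϖM|·|ϖM − ΘϖM| = |T − ρT|`** for every uniformiser `ϖM`
  (the `ρ`-conjugate factor of the quartic minimal polynomial of `ϖM` over `K`: `(ϖM − ρϖM)(ϖM − ΘϖM) = (s₁ − ρs₁)ϖM − (s₂ − ρs₂)`, `s₁ = ϖM + ΘρϖM`, `s₂ = ϖM·ΘρϖM`; ★ p858036's
  §1 at `(Θρ, ρ)`; no fourth-field TYPE is introduced) — i.e. `d_ρ + d_Θ = 2·d_K`, the reading of ★ `F0P3cDyRamKleinDifferentLetters` «at the fourth field» promised in its docstring.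
* §1 (two fields) `valued_add_map_eq_two_of_tube` — the trace token from the TUBE downstairs `|t² − 4D| < |4|·|ϖ|²·|t|²` through a ramified `jE` (`|jE a| = |a|²`) and the eigen-package
  relations; `exists_kUniformizer` — for `j : F →+* M` with `|j y| = |y|⁴`, `r` with `ρr = −r`, `Θρr = r`, `r² = j((u² + 4w)z²)`, an EISENSTEIN pair (`|w| = exp(−1)`, `|u| ≤ exp(−1)`)
  of discriminant depth `|u² + 4w| = |ϖF|^{d_K}`: the root `T = (ju + r∕jz)∕2` (★ `root_sum_and_prod`) is `Θρ`-fixed with `|T| = exp(−2)` and `|T − ρT| = exp(−1)^{2d_K}`.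
HONEST LABEL: HC_CM is proved only modulo the 7 printed citations (2 remaining named inputs: hLiu418 = stmt-HodgeConjecture-24832, h413 = stmt-HodgeConjecture-24833) until rung 0
closes; (ρ2b′-X) stays OPEN; count-neutral valuation bookkeeping — nothing printed is asserted.

## References
* [Serre1979] J.-P. Serre, *Local Fields*, GTM 67 (1979), Ch. III §4 Prop. 8 (transitivity of the different), Ch. IV §1 Prop. 3–4 (`i_G` and the different of a quadratic
  extension), Ch. I §6 Prop. 17–18 (Eisenstein equations, a root is a uniformiser).
* [LabesseLanglands1979] J.-P. Labesse, R. P. Langlands, *L-indistinguishability for SL(2)*, Canad. J. Math. 31 (1979), §2 pp. 7–8 (quadratic tori, conductor of the order).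
* [Rogawski1990] J. D. Rogawski, *Automorphic Representations of Unitary Groups in Three Variables*, Ann. of Math. Stud. 123 (1990), §4.9 Lemma 4.9.3 p. 56 (the eigen-field
  `M = E·K` of a regular element of `U(2)` with its two involutions; the trace in the tube p. 55).
-/

set_option autoImplicit false

noncomputable section

open WithZero
open scoped WithZero

namespace Summit.HodgeConjecture.HodgeConjecture.Cruxes.H413.F0P3cDyRamFourthFieldLetters

/-! ## §1 One-field lemmas -/

section OneField

variable {M : Type*} [Field M] [Valued M ℤᵐ⁰]

/-- `|2| ≤ 1` for any valuation (`2 = 1 + 1`). [cite: Serre1979, Ch. I §6] -/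
theorem valued_two_le_one : Valued.v (2 : M) ≤ 1 := by
  rw [show (2 : M) = 1 + 1 by norm_num]
  exact (Valuation.map_add _ _ _).trans (by rw [Valuation.map_one, max_self])

/-- **THE TRACE TOKEN FROM THE TUBE**: for a unit `lam` (`|lam| = 1`) and a ring endomorphism `ρ`, if `|lam − ρlam| < |2|·|lam + ρlam|` then
`|lam + ρlam| = |2|` (`2·lam = (lam − ρlam) + (lam + ρlam)`). [cite: Rogawski1990, §4.9 p. 55] -/
theorem valued_add_map_eq_two_of_sub_lt (ρ : M →+* M) {lam : M} (hvlam : Valued.v lam = 1)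
    (hlt : Valued.v (lam - ρ lam) < Valued.v (2 : M) * Valued.v (lam + ρ lam)) :
    Valued.v (lam + ρ lam) = Valued.v (2 : M) := by
  have h2lam : Valued.v (2 * lam) = Valued.v (2 : M) := by rw [Valuation.map_mul, hvlam, mul_one]
  have hab : (lam - ρ lam) + (lam + ρ lam) = 2 * lam := by ring
  have hle : Valued.v (lam - ρ lam) < Valued.v (lam + ρ lam) :=
    lt_of_lt_of_le hlt (by simpa using mul_le_mul_left (valued_two_le_one (M := M)) (Valued.v (lam + ρ lam)))
  rcases lt_trichotomy (Valued.v (lam + ρ lam)) (Valued.v (2 : M)) with h | h | h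
  · exfalso
    have hmax : Valued.v (2 * lam) ≤ max (Valued.v (lam - ρ lam)) (Valued.v (lam + ρ lam)) := by
      rw [← hab]; exact Valuation.map_add _ _ _
    rw [h2lam, max_eq_right hle.le] at hmax
    exact absurd h (not_lt.2 hmax)
  · exact h
  · exfalso
    have hsub : lam - ρ lam = 2 * lam - (lam + ρ lam) := by ring
    have h' : Valued.v (2 * lam) < Valued.v (lam + ρ lam) := by rw [h2lam]; exact h
    have := Valuation.map_sub_eq_of_lt_right Valued.v h'
    rw [← hsub] at this
    exact absurd hle (by rw [this]; exact lt_irrefl _)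

/-- **ROOT SIZES**: if `|x·y| = exp(−4)` and `|x + y| ≤ exp(−4)` then `|x| = exp(−2)` (if `|x| ≠ |y|` the sum has the larger value `≥ 1`). [cite: Serre1979, Ch. I §6 Prop. 17] -/
theorem valued_eq_exp_neg_two_of_mul_of_add {x y : M} (hprod : Valued.v (x * y) = exp (-4 : ℤ))
    (hsum : Valued.v (x + y) ≤ exp (-4 : ℤ)) : Valued.v x = exp (-2 : ℤ) := by
  rw [Valuation.map_mul] at hprod
  have hx0 : Valued.v x ≠ 0 := fun h => by rw [h, zero_mul] at hprod; exact (coe_ne_zero hprod.symm).elim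
  have hy0 : Valued.v y ≠ 0 := fun h => by rw [h, mul_zero] at hprod; exact (coe_ne_zero hprod.symm).elim
  have hlog : log (Valued.v x) + log (Valued.v y) = -4 := by
    rw [← exp_log hx0, ← exp_log hy0, ← exp_add, exp_inj] at hprod; exact hprod
  by_cases hxy : Valued.v x = Valued.v y
  · rw [← hxy] at hlog
    rw [← exp_log hx0]
    congr 1; omega
  · exfalso
    have hmax := Valuation.map_add_of_distinct_val Valued.v hxy
    rw [hmax] at hsum
    rw [← exp_log hx0, ← exp_log hy0] at hsum hxy
    rcases le_total (log (Valued.v x)) (log (Valued.v y)) with h | h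
    · rw [max_eq_right (exp_le_exp.2 h), exp_le_exp] at hsum
      have : log (Valued.v x) = log (Valued.v y) := by omega
      exact hxy (by rw [this])
    · rw [max_eq_left (exp_le_exp.2 h), exp_le_exp] at hsum
      have : log (Valued.v x) = log (Valued.v y) := by omega
      exact hxy (by rw [this])

omit [Valued M ℤᵐ⁰] in
/-- **`ρ r₀ = −r₀`** for the ratio witness `r₀ = μ − μ⁻¹`, `μ = lam∕ρlam` (`ρρ = id`: `ρμ = μ⁻¹`). [cite: Rogawski1990, §4.9 Lemma 4.9.3 p. 56] -/
theorem map_ratioWitness_eq_neg (ρ : M →+* M) (hρρ : ∀ z, ρ (ρ z) = z) (lam : M) :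
    ρ (lam / ρ lam - (lam / ρ lam)⁻¹) = -(lam / ρ lam - (lam / ρ lam)⁻¹) := by
  rw [map_sub, map_inv₀, map_div₀, hρρ, inv_div, inv_div]; ring

/-! ### The fourth field `K = Fix(Θρ)` inside `M`: minimality of `d_K` and the Klein letter `d_ρ + d_Θ = 2·d_K` -/

variable (ρ Θ : M →+* M)

/-- **MINIMALITY OF `d_K` INSIDE `M`.**  `ρ`, `Θ` commuting involutions of `M`; doubly fixed non-zero elements have valuation in `exp(4ℤ)` (`e(M ∕ F) = 4`); `T` a `Θρ`-fixed element
of valuation `exp(−2)` (a uniformiser of the fourth field `K = Fix(Θρ)`).  Then every `Θρ`-fixed integer `a` has `|a − ρa| ≤ |T − ρT|` (`a = a₀ + bT` with `a₀, b` doubly fixed,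
`|b| ≤ 1` by parity). [cite: Serre1979, Ch. IV §1 Prop. 4; Ch. I §6 Prop. 18] -/
theorem valued_sub_map_le_of_fixed (hρρ : ∀ z, ρ (ρ z) = z) (hΘΘ : ∀ z, Θ (Θ z) = z)
    (hfix4 : ∀ x : M, ρ x = x → Θ x = x → x ≠ 0 → ∃ n : ℤ, Valued.v x = exp (4 * n))
    {T : M} (hT : Θ (ρ T) = T) (hvT : Valued.v T = exp (-2 : ℤ)) {a : M} (ha : Θ (ρ a) = a) (ha1 : Valued.v a ≤ 1) :
    Valued.v (a - ρ a) ≤ Valued.v (T - ρ T) := by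
  have hT0 : T ≠ 0 := fun h => by rw [h, map_zero] at hvT; exact (coe_ne_zero hvT.symm).elim
  -- `Θ a = ρ a`, `Θ T = ρ T`
  have hΘa : Θ a = ρ a := by have h := congrArg Θ ha; rw [hΘΘ] at h; exact h.symm
  have hΘT : Θ T = ρ T := by have h := congrArg Θ hT; rw [hΘΘ] at h; exact h.symm
  -- `T` is not `ρ`-fixed (else doubly fixed of valuation `exp(−2) ∉ exp(4ℤ)`)
  have hρT : ρ T ≠ T := by
    intro h
    obtain ⟨n, hn⟩ := hfix4 T h (by rw [hΘT, h]) hT0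
    rw [hvT, exp_inj] at hn
    omega
  have hd : T - ρ T ≠ 0 := sub_ne_zero.2 (Ne.symm hρT)
  -- the coordinate `b` and the constant term `a₀`
  set b : M := (a - ρ a) / (T - ρ T) with hb
  have hρb : ρ b = b := by
    rw [hb, map_div₀, map_sub, map_sub, hρρ, hρρ, ← neg_sub a, ← neg_sub T, neg_div_neg_eq]
  have hΘb : Θ b = b := by
    rw [hb, map_div₀, map_sub, map_sub, hΘa, hΘT, ha, hT, ← neg_sub a, ← neg_sub T, neg_div_neg_eq]
  have hkey : a - ρ a = b * (T - ρ T) := by rw [hb, div_mul_cancel₀ _ hd]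
  set a₀ : M := a - b * T with ha₀
  have hρa₀ : ρ a₀ = a₀ := by
    have : a₀ - ρ a₀ = (a - ρ a) - b * (T - ρ T) := by rw [ha₀, map_sub, map_mul, hρb]; ring
    rw [hkey, sub_self, sub_eq_zero] at this
    exact this.symm
  have hΘa₀ : Θ a₀ = a₀ := by
    have h1 : Θ a₀ = ρ a₀ := by rw [ha₀, map_sub, map_mul, hΘb, hΘa, hΘT, map_sub, map_mul, hρb]
    rw [h1, hρa₀]
  -- `|b| ≤ 1`
  have hb1 : Valued.v b ≤ 1 := by
    rcases eq_or_ne b 0 with hb0 | hb0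
    · rw [hb0, map_zero]; exact zero_le
    obtain ⟨n, hn⟩ := hfix4 b hρb hΘb hb0
    have hvbT : Valued.v (b * T) = exp (4 * n + (-2)) := by rw [Valuation.map_mul, hn, hvT, exp_add]
    have hbT_le : Valued.v (b * T) ≤ 1 := by
      rcases eq_or_ne a₀ 0 with h0 | h0
      · have : a = b * T := by rw [ha₀, sub_eq_zero] at h0; exact h0
        rw [← this]; exact ha1
      · obtain ⟨m, hm⟩ := hfix4 a₀ hρa₀ hΘa₀ h0
        have hne : Valued.v a₀ ≠ Valued.v (b * T) := by
          rw [hm, hvbT, Ne, exp_inj]; omega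
        have hsum : a = a₀ + b * T := by rw [ha₀]; ring
        have hmax := Valuation.map_add_of_distinct_val Valued.v hne
        rw [← hsum] at hmax
        calc Valued.v (b * T) ≤ max (Valued.v a₀) (Valued.v (b * T)) := le_max_right _ _
          _ = Valued.v a := hmax.symm
          _ ≤ 1 := ha1
    rw [hvbT, ← exp_zero, exp_le_exp] at hbT_le
    rw [hn, ← exp_zero, exp_le_exp]
    omega
  rw [hkey, Valuation.map_mul]
  calc Valued.v b * Valued.v (T - ρ T) ≤ 1 * Valued.v (T - ρ T) := mul_le_mul_left hb1 _
    _ = Valued.v (T - ρ T) := one_mul _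

/-- **THE KLEIN LETTER AT THE FOURTH FIELD, INSIDE `M`: `|ϖM − ρϖM|·|ϖM − ΘϖM| = |T − ρT|`** (`d_ρ + d_Θ = 2·d_K`) for every uniformiser `ϖM` of `M` (`|ϖM| = exp(−1)`), with `ρ, Θ`
commuting isometric involutions, doubly fixed non-zero elements of valuation in `exp(4ℤ)`, and `T` a `Θρ`-fixed element of valuation `exp(−2)`.  Proof: the `ρ`-conjugate factor of the
quartic minimal polynomial of `ϖM` over the fourth field, `(ϖM − ρϖM)(ϖM − ΘϖM) = (s₁ − ρs₁)ϖM − (s₂ − ρs₂)` with `s₁ = ϖM + ΘρϖM`, `s₂ = ϖM·ΘρϖM` (★ Klein §1), and the minimality lemma.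
[cite: Serre1979, Ch. III §4 Prop. 8; Ch. IV §1 Prop. 4] -/
theorem v_sub_mul_v_sub_eq_of_kUniformizer (hρρ : ∀ z, ρ (ρ z) = z) (hΘΘ : ∀ z, Θ (Θ z) = z) (hΘρ : ∀ z, Θ (ρ z) = ρ (Θ z))
    (hvρ : ∀ z, Valued.v (ρ z) = Valued.v z) (hvΘ : ∀ z, Valued.v (Θ z) = Valued.v z)
    (hfix4 : ∀ x : M, ρ x = x → Θ x = x → x ≠ 0 → ∃ n : ℤ, Valued.v x = exp (4 * n))
    {T : M} (hT : Θ (ρ T) = T) (hvT : Valued.v T = exp (-2 : ℤ)) {ϖM : M} (hϖM : Valued.v ϖM = exp (-1 : ℤ)) :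
    Valued.v (ϖM - ρ ϖM) * Valued.v (ϖM - Θ ϖM) = Valued.v (T - ρ T) := by
  have hT0 : T ≠ 0 := fun h => by rw [h, map_zero] at hvT; exact (coe_ne_zero hvT.symm).elim
  have hΘT : Θ T = ρ T := by have h := congrArg Θ hT; rw [hΘΘ] at h; exact h.symm
  have hρT : ρ T ≠ T := by
    intro h
    obtain ⟨n, hn⟩ := hfix4 T h (by rw [hΘT, h]) hT0
    rw [hvT, exp_inj] at hn
    omega
  have hd : Valued.v (T - ρ T) ≠ 0 := (Valuation.ne_zero_iff _).2 (sub_ne_zero.2 (Ne.symm hρT))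
  have hdpos : 0 < Valued.v (T - ρ T) := zero_lt_iff.2 hd
  -- `s₁`, `s₂` and the ring identity
  have hρΘρ : ρ (Θ (ρ ϖM)) = Θ ϖM := by rw [← hΘρ, hρρ]
  have key : (ϖM - ρ ϖM) * (ϖM - Θ ϖM) = ((ϖM + Θ (ρ ϖM)) - ρ (ϖM + Θ (ρ ϖM))) * ϖM - (ϖM * Θ (ρ ϖM) - ρ (ϖM * Θ (ρ ϖM))) := by
    rw [map_add, map_mul, hρΘρ]; ring
  have hs₁fix : Θ (ρ (ϖM + Θ (ρ ϖM))) = ϖM + Θ (ρ ϖM) := by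
    rw [map_add, map_add, hρΘρ, hΘΘ, add_comm]
  have hs₂fix : Θ (ρ (ϖM * Θ (ρ ϖM))) = ϖM * Θ (ρ ϖM) := by
    rw [map_mul, map_mul, hρΘρ, hΘΘ, mul_comm]
  have hvs₂ : Valued.v (ϖM * Θ (ρ ϖM)) = exp (-2 : ℤ) := by
    rw [Valuation.map_mul, hvΘ, hvρ, hϖM, ← exp_add]; norm_num
  -- `s₂ = c·T` with `c` a `Θρ`-fixed unit
  set c : M := ϖM * Θ (ρ ϖM) / T with hc
  have hcfix : Θ (ρ c) = c := by rw [hc, map_div₀, map_div₀, hs₂fix, hT]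
  have hvc : Valued.v c = 1 := by rw [hc, map_div₀, hvs₂, hvT, div_self (coe_ne_zero)]
  have hs₂c : ϖM * Θ (ρ ϖM) = c * T := by rw [hc, div_mul_cancel₀ _ hT0]
  have hcmin := valued_sub_map_le_of_fixed ρ Θ hρρ hΘΘ hfix4 hT hvT hcfix hvc.le
  have hvs₂' : Valued.v (ϖM * Θ (ρ ϖM) - ρ (ϖM * Θ (ρ ϖM))) = Valued.v (T - ρ T) := by
    have hdec : ϖM * Θ (ρ ϖM) - ρ (ϖM * Θ (ρ ϖM)) = c * (T - ρ T) + ρ T * (c - ρ c) := by rw [hs₂c, map_mul]; ring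
    have h1 : Valued.v (c * (T - ρ T)) = Valued.v (T - ρ T) := by rw [Valuation.map_mul, hvc, one_mul]
    have h2 : Valued.v (ρ T * (c - ρ c)) < Valued.v (T - ρ T) := by
      rw [Valuation.map_mul, hvρ, hvT]
      calc exp (-2 : ℤ) * Valued.v (c - ρ c) ≤ exp (-2 : ℤ) * Valued.v (T - ρ T) := mul_le_mul_right hcmin _
        _ < 1 * Valued.v (T - ρ T) := by
            refine mul_lt_mul_of_pos_right ?_ hdpos
            rw [← exp_zero, exp_lt_exp]; norm_num
        _ = Valued.v (T - ρ T) := one_mul _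
    rw [hdec, Valuation.map_add_eq_of_lt_left _ (by rw [h1]; exact h2), h1]
  -- `s₁` is a `Θρ`-fixed integer
  have hvs₁ : Valued.v (ϖM + Θ (ρ ϖM)) ≤ 1 := by
    refine (Valuation.map_add _ _ _).trans (max_le ?_ ?_)
    · rw [hϖM, ← exp_zero, exp_le_exp]; norm_num
    · rw [hvΘ, hvρ, hϖM, ← exp_zero, exp_le_exp]; norm_num
  have hs₁min := valued_sub_map_le_of_fixed ρ Θ hρρ hΘΘ hfix4 hT hvT hs₁fix hvs₁
  have hlt : Valued.v (((ϖM + Θ (ρ ϖM)) - ρ (ϖM + Θ (ρ ϖM))) * ϖM) < Valued.v (ϖM * Θ (ρ ϖM) - ρ (ϖM * Θ (ρ ϖM))) := by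
    rw [hvs₂', Valuation.map_mul, hϖM]
    calc Valued.v ((ϖM + Θ (ρ ϖM)) - ρ (ϖM + Θ (ρ ϖM))) * exp (-1 : ℤ) ≤ Valued.v (T - ρ T) * exp (-1 : ℤ) := mul_le_mul_left hs₁min _
      _ < Valued.v (T - ρ T) * 1 := by
          refine mul_lt_mul_of_pos_left ?_ hdpos
          rw [← exp_zero, exp_lt_exp]; norm_num
      _ = Valued.v (T - ρ T) := mul_one _
  rw [← Valuation.map_mul, key, Valuation.map_sub_swap, Valuation.map_sub_eq_of_lt_left _ hlt, hvs₂']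

/-! ### Two fields: the trace token through `jE`, and the fourth-field uniformiser from an Eisenstein datum -/

omit [Valued M ℤᵐ⁰] in
/-- Eigen-package algebra: `lam + ρlam = jE t` and `(lam − ρlam)² = jE(t² − 4D)` give `jE(4·t²) = (2(lam + ρlam))²`. [cite: Rogawski1990, §4.9 Lemma 4.9.3 p. 56] -/
theorem map_four_mul_sq_eq {E : Type*} [Field E] (jE : E →+* M) {t : E} {lam : M} (hsum : lam + ρ lam = jE t) :
    jE (4 * t ^ 2) = (2 * (lam + ρ lam)) ^ 2 := by
  rw [map_mul, map_pow, map_ofNat, ← hsum]; ring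

/-- **THE TRACE TOKEN THROUGH A RAMIFIED `jE`** (`|jE a| = |a|²`): the tube `|t² − 4D| < |4|·|ϖ|²·|t|²` downstairs (`|ϖ| ≤ 1`) and the eigen-package relations
`lam² = jE t·lam − jE D`, `ρlam = jE t − lam` for a unit `lam` give `|lam + ρlam| = |2|`. [cite: Rogawski1990, §4.9 p. 55] -/
theorem valued_add_map_eq_two_of_tube {E : Type*} [Field E] [Valued E ℤᵐ⁰] (jE : E →+* M) (hjE2 : ∀ a, Valued.v (jE a) = Valued.v a ^ 2)
    {t D : E} {lam : M} (hlam2 : lam * lam = jE t * lam - jE D) (hρlam : ρ lam = jE t - lam) (hvlam : Valued.v lam = 1)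
    {ϖ : E} (hϖ1 : Valued.v ϖ ≤ 1) (htube : Valued.v (t ^ 2 - 4 * D) < Valued.v (4 : E) * Valued.v ϖ ^ 2 * Valued.v t ^ 2) :
    Valued.v (lam + ρ lam) = Valued.v (2 : M) := by
  obtain ⟨hsum, hsq⟩ := F0P3cDyRamHSideLevelLetter.add_map_eq_and_sub_map_sq_eq jE ρ hlam2 hρlam
  refine valued_add_map_eq_two_of_sub_lt ρ hvlam ?_
  have hϖ2 : Valued.v ϖ ^ 2 ≤ 1 := pow_le_one₀ zero_le hϖ1
  have h1 : Valued.v (t ^ 2 - 4 * D) < Valued.v ((4 : E) * t ^ 2) := by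
    refine lt_of_lt_of_le htube ?_
    rw [Valuation.map_mul, Valuation.map_pow]
    calc Valued.v (4 : E) * Valued.v ϖ ^ 2 * Valued.v t ^ 2 ≤ Valued.v (4 : E) * 1 * Valued.v t ^ 2 := by gcongr
      _ = Valued.v (4 : E) * Valued.v t ^ 2 := by rw [mul_one]
  have h2 : Valued.v (jE (t ^ 2 - 4 * D)) < Valued.v (jE (4 * t ^ 2)) := by
    rw [hjE2, hjE2]; exact pow_lt_pow_left₀ h1 zero_le two_ne_zero
  rw [← hsq, map_four_mul_sq_eq ρ jE hsum, Valuation.map_pow, Valuation.map_pow] at h2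
  rw [← Valuation.map_mul]
  exact lt_of_pow_lt_pow_left' 2 h2

/-- **THE FOURTH-FIELD UNIFORMISER FROM AN EISENSTEIN DATUM.**  `j : F →+* M` with `|j y| = |y|⁴` (`e(M ∕ F) = 4`), fixed by `ρ` and `Θ`; `r ∈ M` with `ρr = −r`, `Θρ r = r` and
`r² = j((u² + 4w)·z²)` for an EISENSTEIN pair (`|w| = exp(−1)`, `|u| ≤ exp(−1)`) of discriminant depth `|u² + 4w| = |ϖF|^{d_K}` (`|ϖF| = exp(−1)`, `z ≠ 0`, `2 ≠ 0`).  Then the root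
`T = (ju + r∕jz)∕2` (★ `root_sum_and_prod`) is `Θρ`-FIXED, has `|T| = exp(−2)` and `|T − ρT| = exp(−1)^{2·d_K}`. [cite: Serre1979, Ch. I §6 Prop. 17–18] [cite: LabesseLanglands1979, §2 p. 8] -/
theorem exists_kUniformizer {F : Type*} [Field F] [Valued F ℤᵐ⁰] (j : F →+* M) (h2 : (2 : M) ≠ 0)
    (hj4 : ∀ y, Valued.v (j y) = Valued.v y ^ 4) (hjρ : ∀ y, ρ (j y) = j y) (hjΘ : ∀ y, Θ (j y) = j y)
    {r : M} (hρr : ρ r = -r) (hΘρr : Θ (ρ r) = r)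
    {u w z ϖF : F} {dK : ℕ} (hz : z ≠ 0) (hr : r ^ 2 = j ((u ^ 2 + 4 * w) * z ^ 2))
    (hvw : Valued.v w = exp (-1 : ℤ)) (hvu : Valued.v u ≤ exp (-1 : ℤ)) (hϖF : Valued.v ϖF = exp (-1 : ℤ))
    (hdK : Valued.v (u ^ 2 + 4 * w) = Valued.v ϖF ^ dK) :
    ∃ T : M, Θ (ρ T) = T ∧ Valued.v T = exp (-2 : ℤ) ∧ Valued.v (T - ρ T) = exp (-1 : ℤ) ^ (2 * dK) := by
  obtain ⟨hsum, hprod⟩ := Literature.NumberTheory.Automorphic.HermitianLatticeTree.root_sum_and_prod j h2 (D := (u ^ 2 + 4 * w) * z ^ 2) rfl hz hr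
  have hρT := Literature.NumberTheory.Automorphic.HermitianLatticeTree.map_root_eq_conj j ρ hjρ (u := u) (z := z) hρr h2
  have hΘρT := Literature.NumberTheory.Automorphic.HermitianLatticeTree.map_map_root_eq j ρ Θ hjρ hjΘ (u := u) (z := z) hΘρr
  refine ⟨(j u + r / j z) / 2, hΘρT, ?_, ?_⟩
  · refine valued_eq_exp_neg_two_of_mul_of_add (y := j u - (j u + r / j z) / 2) ?_ ?_
    · rw [hprod, Valuation.map_neg, hj4, hvw, ← exp_nsmul]; norm_num
    · rw [hsum, hj4]
      calc Valued.v u ^ 4 ≤ exp (-1 : ℤ) ^ 4 := pow_le_pow_left₀ zero_le hvu 4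
        _ = exp (-4 : ℤ) := by rw [← exp_nsmul]; norm_num
  · have hjz : j z ≠ 0 := (map_ne_zero j).2 hz
    have hdiff : (j u + r / j z) / 2 - ρ ((j u + r / j z) / 2) = r / j z := by
      rw [hρT]; field_simp; ring
    have hratio : ((j u + r / j z) / 2 - ρ ((j u + r / j z) / 2)) ^ 2 = j (u ^ 2 + 4 * w) := by
      rw [hdiff, div_pow, hr, map_mul, map_pow, mul_div_assoc, div_self (pow_ne_zero 2 hjz), mul_one]
    have hsq2 : Valued.v ((j u + r / j z) / 2 - ρ ((j u + r / j z) / 2)) ^ 2 = (exp (-1 : ℤ) ^ (2 * dK)) ^ 2 := by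
      rw [← Valuation.map_pow, hratio, hj4, hdK, hϖF, ← pow_mul, ← pow_mul]
      ring_nf
    exact (pow_left_inj₀ zero_le zero_le two_ne_zero).1 hsq2

end OneField

/-! ## §2 (ED. 2) The type-RamK twin: `|j y| = |y|²` — the Eisenstein root is a `Θρ`-fixed uniformiser of `M` with `|T − ρT| = exp(−1)^{d_K}`
(payer LH4-p14 (g5) ∕ LH4-p12 (g5) (B-dK) «`d_K = d` on type RamK», 2026-09-04T07:12Z) -/

section RamK

variable {M : Type*} [Field M] [Valued M ℤᵐ⁰]

/-- **ROOT SIZES, any negative even level**: if `|x·y| = exp(2k)` and `|x + y| ≤ exp(2k)` with `k < 0` then `|x| = exp(k)` (if `|x| ≠ |y|` the sum has the larger value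
`≤ exp(2k)`, so the smaller one would be `≥ 1 > exp(2k)`). [cite: Serre1979, Ch. I §6 Prop. 17] -/
theorem valued_eq_exp_of_mul_of_add {x y : M} {k : ℤ} (hk : k < 0) (hprod : Valued.v (x * y) = exp (2 * k))
    (hsum : Valued.v (x + y) ≤ exp (2 * k)) : Valued.v x = exp k := by
  rw [Valuation.map_mul] at hprod
  have hx0 : Valued.v x ≠ 0 := fun h => by rw [h, zero_mul] at hprod; exact (coe_ne_zero hprod.symm).elim
  have hy0 : Valued.v y ≠ 0 := fun h => by rw [h, mul_zero] at hprod; exact (coe_ne_zero hprod.symm).elim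
  have hlog : log (Valued.v x) + log (Valued.v y) = 2 * k := by
    rw [← exp_log hx0, ← exp_log hy0, ← exp_add, exp_inj] at hprod; exact hprod
  by_cases hxy : Valued.v x = Valued.v y
  · rw [← hxy] at hlog
    rw [← exp_log hx0]
    congr 1; omega
  · exfalso
    have hmax := Valuation.map_add_of_distinct_val Valued.v hxy
    rw [hmax] at hsum
    rw [← exp_log hx0, ← exp_log hy0] at hsum hxy
    rcases le_total (log (Valued.v x)) (log (Valued.v y)) with h | h
    · rw [max_eq_right (exp_le_exp.2 h), exp_le_exp] at hsum
      have : log (Valued.v x) = log (Valued.v y) := by omega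
      exact hxy (by rw [this])
    · rw [max_eq_left (exp_le_exp.2 h), exp_le_exp] at hsum
      have : log (Valued.v x) = log (Valued.v y) := by omega
      exact hxy (by rw [this])

variable (ρ Θ : M →+* M)

/-- **THE EISENSTEIN ROOT AT TYPE RamK** (`e(M ∕ F) = 2`): `j : F →+* M` with `|j y| = |y|²`, fixed by `ρ` and `Θ`; `r ∈ M` with `ρr = −r`, `Θρ r = r`, `r² = j((u² + 4w)·z²)` for an
EISENSTEIN pair (`|w| = exp(−1)`, `|u| ≤ exp(−1)`) of discriminant depth `|u² + 4w| = |ϖF|^{d_K}` (`|ϖF| = exp(−1)`, `z ≠ 0`, `2 ≠ 0`).  Then the root `T = (ju + r∕jz)∕2` is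
`Θρ`-FIXED, is a UNIFORMISER of `M` (`|T| = exp(−1)`), and `|T − ρT| = exp(−1)^{d_K}` — so with a `Θ`-datum of exponent `d` on `M` (★ LH4-p12 (g5) `v_sub_rho_eq_of_tau_fixed`:
`|T − ρT| = |T|^d`) one reads `d_K = d`. [cite: Serre1979, Ch. I §6 Prop. 17–18] [cite: LabesseLanglands1979, §2 p. 8] -/
theorem exists_mUniformizer_of_sq {F : Type*} [Field F] [Valued F ℤᵐ⁰] (j : F →+* M) (h2 : (2 : M) ≠ 0)
    (hj2 : ∀ y, Valued.v (j y) = Valued.v y ^ 2) (hjρ : ∀ y, ρ (j y) = j y) (hjΘ : ∀ y, Θ (j y) = j y)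
    {r : M} (hρr : ρ r = -r) (hΘρr : Θ (ρ r) = r)
    {u w z ϖF : F} {dK : ℕ} (hz : z ≠ 0) (hr : r ^ 2 = j ((u ^ 2 + 4 * w) * z ^ 2))
    (hvw : Valued.v w = exp (-1 : ℤ)) (hvu : Valued.v u ≤ exp (-1 : ℤ)) (hϖF : Valued.v ϖF = exp (-1 : ℤ))
    (hdK : Valued.v (u ^ 2 + 4 * w) = Valued.v ϖF ^ dK) :
    ∃ T : M, Θ (ρ T) = T ∧ Valued.v T = exp (-1 : ℤ) ∧ Valued.v (T - ρ T) = exp (-1 : ℤ) ^ dK := by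
  obtain ⟨hsum, hprod⟩ := Literature.NumberTheory.Automorphic.HermitianLatticeTree.root_sum_and_prod j h2 (D := (u ^ 2 + 4 * w) * z ^ 2) rfl hz hr
  have hρT := Literature.NumberTheory.Automorphic.HermitianLatticeTree.map_root_eq_conj j ρ hjρ (u := u) (z := z) hρr h2
  have hΘρT := Literature.NumberTheory.Automorphic.HermitianLatticeTree.map_map_root_eq j ρ Θ hjρ hjΘ (u := u) (z := z) hΘρr
  refine ⟨(j u + r / j z) / 2, hΘρT, ?_, ?_⟩
  · refine valued_eq_exp_of_mul_of_add (y := j u - (j u + r / j z) / 2) (k := -1) (by norm_num) ?_ ?_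
    · rw [hprod, Valuation.map_neg, hj2, hvw, ← exp_nsmul]; norm_num
    · rw [hsum, hj2]
      calc Valued.v u ^ 2 ≤ exp (-1 : ℤ) ^ 2 := pow_le_pow_left₀ zero_le hvu 2
        _ = exp (2 * (-1 : ℤ)) := by rw [← exp_nsmul]; norm_num
  · have hjz : j z ≠ 0 := (map_ne_zero j).2 hz
    have hdiff : (j u + r / j z) / 2 - ρ ((j u + r / j z) / 2) = r / j z := by
      rw [hρT]; field_simp; ring
    have hratio : ((j u + r / j z) / 2 - ρ ((j u + r / j z) / 2)) ^ 2 = j (u ^ 2 + 4 * w) := by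
      rw [hdiff, div_pow, hr, map_mul, map_pow, mul_div_assoc, div_self (pow_ne_zero 2 hjz), mul_one]
    have hsq2 : Valued.v ((j u + r / j z) / 2 - ρ ((j u + r / j z) / 2)) ^ 2 = (exp (-1 : ℤ) ^ dK) ^ 2 := by
      rw [← Valuation.map_pow, hratio, hj2, hdK, hϖF]
    exact (pow_left_inj₀ zero_le zero_le two_ne_zero).1 hsq2

end RamK

end Summit.HodgeConjecture.HodgeConjecture.Cruxes.H413.F0P3cDyRamFourthFieldLetters

end
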